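import Literature.NumberTheory.EllipticCurves.Sprung2017.HalfLogarithmMatrixInvolutionModThreeProofs
import Summits.BirchSwinnertonDyer.BirchSwinnertonDyer.Theorems.SignedLowerHalvesSprungLowerDivisibilityAtThreeIotaStability
import Summits.BirchSwinnertonDyer.BirchSwinnertonDyer.Theorems.SignedLowerHalvesSprungLowerDivisibilityAtThreeBothColours
import Summits.BirchSwinnertonDyer.BirchSwinnertonDyer.Theorems.SignedLowerHalvesSprungLowerDivisibilityAtThreeSlopeSeparation
import HarnessLib

/-!
# Crux `SprungLowerDivisibilityAtThree` (K1, item stmt-BirchSwinnertonDyer-19875), line `chromatic-common-zeros`: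
# MOD 3 THE TWO COLOURS DECOUPLE UNDER ι, and THE PARITY OF λ — `(−1)^{λ(L♯)} = (−1)^{λ(L♭)} = σ` (the Fricke sign)
# for every X8 Sprung pair with `μ = 0` (class-wide, input-free)

Cell `bsd-ssimc` (host), width seat `cruxlead-stmt-BirchSwinnertonDyer-19875-w3` (gen 4) under the 19875 lead; `--supports`
19875 `--as helper`; theorems only; closes NO item (skeleton v8 unchanged). K1, BSD and leaf X8 are NOT proved by anything here.

## What is proved

The transition matrix `M` of `ℒ = M·ℒ(T^ι)` is DIAGONAL MOD 3 with diagonal `≡ 1 (mod T)`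
(`exists_integral_halfLogMatrix_eq_mul_subst_modThree`, p638807: `a₃ = 3b` kills `u_{2m}`, `v_{2m+1}` mod 3). Cancelling `ℒ`
in the trace-coordinate functional equation (PROVED, p621498) as in `…IotaStability` gives, in `Λ = ℤ₃⟦T⟧`,
`κ′·L♯(T^ι) = M₀₀·L♯ + M₁₀·L♭` and `κ′·L♭(T^ι) = M₀₁·L♯ + M₁₁·L♭` with `κ′(0) = σ = ±1` (`f|W_N = −σf`), hence
**`κ′·L^•(T^ι) ≡ m_•·L^• (mod 3Λ)`, `m_•(0) = 1`** — a mod-3 functional equation for EACH colour (`ClassX8.subst_congr_modThree`).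
Reducing a colour with `μ(L^•) = 0` modulo `3` (`L̄^• = T^λ·w`, `w(0) ≠ 0`, `T^ι ≡ −T(1+ι)`) and comparing leading
coefficients (§1, `neg_one_pow_lam_eq_of_subst_congr`, pure `Λ`-algebra, `p ≠ 2`):

* **`ClassX8.neg_one_pow_lam_eq_frickeSign`** — for every X8 pair, newform `f` with `f|W_N = −σf`, Sprung pair and colour `•`
  with `μ(L^•) = 0`: `(−1)^{λ(L^•)} = σ`.
* **`ClassX8.lam_sharp_mod_two_eq_lam_flat_mod_two`** — `μ(L♯) = μ(L♭) = 0 ⟹ λ(L♯) ≡ λ(L♭) (mod 2)` (σ-free).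

This EXPLAINS the census datum «`λ♯ ≡ λ♭ ≡ r_an (mod 2)` on 217/217 cells» (with `σ = w(E) = (−1)^{r_an}`, the tree's
`HasFunctionalEquationSign.cast_eq_neg_one_pow_analyticRank`, not re-derived here), although NO individual colour has a functional
equation over `ℤ₃` (`M` is not diagonal: w3 g2's non-vanishing row twists). For the line: a common prime argument at `λ♯ ≠ λ♭` may
assume `|λ♯ − λ♭| ≥ 2`; `λ(L^•) = 1` never happens when `σ = +1`.
-- TODO(general form): the `a_p = 0` analogue is Pollack 2003 / Kim (each `L^±` has its own functional equation); here `p = 3`,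
-- `a₃ = ±3` only.

References: [Sprung2017] Thm. 4.13, Cor. 4.14, Prop. 3.14, Cor. 4.4; [GreenbergLNM1716] §1, Prop. 3.10; [MazurTateTeitelbaum1986Invent]
§I.17; [Washington1997] §7.1.
-/

set_option linter.dupNamespace false
set_option autoImplicit false

noncomputable section

open scoped Classical MatrixGroups ModularForm

open CongruenceSubgroup WeierstrassCurve Polynomial
  Literature.NumberTheory.EllipticCurves Literature.NumberTheory.EllipticCurves.ModularForms
  Literature.NumberTheory.EllipticCurves.Sprung2017 Literature.NumberTheory.EllipticCurves.Rank1Residual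
  Literature.Barriers.BirchSwinnertonDyer Summit.BirchSwinnertonDyer.Rank1Residual.Supersingular
  Summit.BirchSwinnertonDyer.Rank1Residual.X1.MuLambda
  Summit.BirchSwinnertonDyer.BirchSwinnertonDyer.Theorems.ChromaticSlopeSeparation

namespace Summit.BirchSwinnertonDyer.BirchSwinnertonDyer.Theorems.ChromaticIota

/-! ## §1 The parity of `λ` from a mod-`p` functional equation (pure `Λ`-algebra) -/

section Algebra

variable {p : ℕ} [hp : Fact p.Prime]

/-- `[T^e] G(T^ι) = Σ_{d ≤ e} G_d·[T^e](T^ι)^d` over any ring (private plumbing). [folklore] -/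
private theorem coeff_subst_iota_eq_sum {R : Type*} [CommRing R] (G : PowerSeries R) (e : ℕ) :
    PowerSeries.coeff e (PowerSeries.subst (invOnePlusSubOne : PowerSeries R) G) =
      ∑ d ∈ Finset.range (e + 1), PowerSeries.coeff d G *
        PowerSeries.coeff e ((invOnePlusSubOne : PowerSeries R) ^ d) := by
  have h0 : PowerSeries.constantCoeff (invOnePlusSubOne : PowerSeries R) = 0 := constantCoeff_invOnePlusSubOne
  rw [PowerSeries.coeff_subst' (PowerSeries.HasSubst.of_constantCoeff_zero' h0),
    finsum_eq_sum_of_support_subset _ (s := Finset.range (e + 1)) ?_]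
  · simp only [smul_eq_mul]
  · intro d hd
    simp only [Function.mem_support, ne_eq, Finset.coe_range, Set.mem_Iio] at hd ⊢
    by_contra hlt
    apply hd
    rw [PowerSeries.coeff_of_lt_order e (lt_of_lt_of_le (by exact_mod_cast (by omega : e < d))
      (natCast_le_order_pow h0 d)), smul_zero]

/-- `G(T^ι)(0) = G(0)` (private plumbing). [folklore] -/
private theorem constantCoeff_subst_iota {R : Type*} [CommRing R] (G : PowerSeries R) :
    PowerSeries.constantCoeff (PowerSeries.subst (invOnePlusSubOne : PowerSeries R) G) = PowerSeries.constantCoeff G := by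
  rw [← PowerSeries.coeff_zero_eq_constantCoeff_apply, coeff_subst_iota_eq_sum, Finset.sum_range_one, pow_zero,
    PowerSeries.coeff_zero_eq_constantCoeff_apply, PowerSeries.coeff_zero_eq_constantCoeff, map_one, mul_one]

/-- `(map f φ)(0) = f(φ(0))` (private plumbing). [folklore] -/
private theorem constantCoeff_map' {R S : Type*} [CommRing R] [CommRing S] (φ : R →+* S) (G : PowerSeries R) :
    PowerSeries.constantCoeff (PowerSeries.map φ G) = φ (PowerSeries.constantCoeff G) := by
  rw [← PowerSeries.coeff_zero_eq_constantCoeff_apply, PowerSeries.coeff_map, PowerSeries.coeff_zero_eq_constantCoeff_apply]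

/-- `ι` has integer coefficients: reduction modulo `p` maps `ι` to `ι` (private plumbing). [folklore] -/
private theorem map_invOnePlusSubOne' {R S : Type*} [CommRing R] [CommRing S] (φ : R →+* S) :
    PowerSeries.map φ (invOnePlusSubOne : PowerSeries R) = invOnePlusSubOne := by
  ext n
  simp only [PowerSeries.coeff_map, coeff_invOnePlusSubOne]
  split_ifs <;> simp

/-- **Parity of `λ` from a functional equation modulo `p`.** Let `F ∈ Λ = ℤ_p⟦T⟧` (`p ≠ 2`), `F ≠ 0`, `μ(F) = 0`, and suppose
`κ·F(T^ι) = m·F + p·G` with `m(0) = 1` and `κ(0) = s ∈ {1, −1}`. Then `(−1)^{λ(F)} = s`. Proof: modulo `p`, `F̄ = T^λ·w` with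
`w(0) ≠ 0` and `F̄(T^ι) = (T^ι)^λ·w(T^ι) = (−1)^λ T^λ (1+ι)^λ w(T^ι)`; cancel `T^λ` and read constant coefficients:
`s·(−1)^λ·w(0) = w(0)` in `𝔽_p`. [cite: GreenbergLNM1716, §1 and Prop. 3.10] [cite: Washington1997, §7.1] -/
theorem neg_one_pow_lam_eq_of_subst_congr (hp2 : p ≠ 2) {F κ m G : IwasawaAlgebra p} (hF0 : F ≠ 0) (hμ : mu F = 0)
    {s : ℤ} (hs : s = 1 ∨ s = -1) (hκ0 : PowerSeries.constantCoeff κ = s) (hm0 : PowerSeries.constantCoeff m = 1)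
    (h : κ * PowerSeries.subst (invOnePlusSubOne : IwasawaAlgebra p) F = m * F + PowerSeries.C (p : ℤ_[p]) * G) :
    (-1 : ℤ) ^ lam F = s := by
  -- reduce modulo `p`
  set π := IsLocalRing.residue ℤ_[p] with hπ
  have hιp := hasSubst_invOnePlusSubOne (R := ℤ_[p])
  have hιk := hasSubst_invOnePlusSubOne (R := IsLocalRing.ResidueField ℤ_[p])
  have hred : PowerSeries.map π (PowerSeries.subst (invOnePlusSubOne : IwasawaAlgebra p) F) =
      PowerSeries.subst (invOnePlusSubOne : PowerSeries (IsLocalRing.ResidueField ℤ_[p])) (PowerSeries.map π F) := by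
    have h1 := PowerSeries.map_subst hιp (h := π) F
    have hιmap : MvPowerSeries.map π (invOnePlusSubOne : IwasawaAlgebra p) = invOnePlusSubOne :=
      map_invOnePlusSubOne' π
    rw [hιmap] at h1
    exact h1
  have hpπ : π (p : ℤ_[p]) = 0 := by
    rw [hπ, IsLocalRing.residue_eq_zero_iff, PadicInt.maximalIdeal_eq_span_p]
    exact Ideal.mem_span_singleton_self _
  have hbar : PowerSeries.map π κ *
      PowerSeries.subst (invOnePlusSubOne : PowerSeries (IsLocalRing.ResidueField ℤ_[p])) (PowerSeries.map π F) =
      PowerSeries.map π m * PowerSeries.map π F := by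
    have h1 := congrArg (PowerSeries.map π) h
    rw [map_mul, map_add, map_mul, map_mul, hred, PowerSeries.map_C, hpπ, map_zero, zero_mul, add_zero] at h1
    exact h1
  -- `F̄ = T^λ · w`, `w(0) ≠ 0`
  obtain ⟨hred0, hord⟩ := red_ne_zero_and_lam_eq_order hF0 hμ
  set f : PowerSeries (IsLocalRing.ResidueField ℤ_[p]) := PowerSeries.map π F with hf
  have hfne : f ≠ 0 := hred0
  have hordnat : f.order.toNat = lam F := by
    apply_fun ENat.toNat at hord
    simpa using hord.symm
  obtain ⟨w, hw⟩ := PowerSeries.X_pow_order_dvd (φ := f)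
  rw [hordnat] at hw
  have hw0 : PowerSeries.constantCoeff w ≠ 0 := by
    have hc := PowerSeries.coeff_order hfne
    rw [hordnat, hw, PowerSeries.coeff_X_pow_mul', if_pos le_rfl, Nat.sub_self,
      PowerSeries.coeff_zero_eq_constantCoeff_apply] at hc
    exact hc
  -- `f(T^ι) = (−T(1+ι))^λ · w(T^ι)`
  set E : PowerSeries (IsLocalRing.ResidueField ℤ_[p]) := invOnePlusSubOne + 1 with hE
  have hιX : (invOnePlusSubOne : PowerSeries (IsLocalRing.ResidueField ℤ_[p])) = -PowerSeries.X * E :=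
    invOnePlusSubOne_eq_neg_X_mul
  have hsubf : PowerSeries.subst (invOnePlusSubOne : PowerSeries (IsLocalRing.ResidueField ℤ_[p])) f =
      (-1) ^ lam F * PowerSeries.X ^ lam F * (E ^ lam F *
        PowerSeries.subst (invOnePlusSubOne : PowerSeries (IsLocalRing.ResidueField ℤ_[p])) w) := by
    rw [hw, PowerSeries.subst_mul hιk, PowerSeries.subst_pow hιk, PowerSeries.subst_X hιk, hιX]
    ring
  -- cancel `T^λ` and read the constant coefficients
  rw [hsubf, hw] at hbar
  have hX0 : (PowerSeries.X : PowerSeries (IsLocalRing.ResidueField ℤ_[p])) ^ lam F ≠ 0 := pow_ne_zero _ PowerSeries.X_ne_zero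
  have hcancel : PowerSeries.map π κ * (-1) ^ lam F * (E ^ lam F *
      PowerSeries.subst (invOnePlusSubOne : PowerSeries (IsLocalRing.ResidueField ℤ_[p])) w) = PowerSeries.map π m * w := by
    have h2 : PowerSeries.X ^ lam F * (PowerSeries.map π κ * (-1) ^ lam F * (E ^ lam F *
        PowerSeries.subst (invOnePlusSubOne : PowerSeries (IsLocalRing.ResidueField ℤ_[p])) w)) =
        PowerSeries.X ^ lam F * (PowerSeries.map π m * w) := by
      rw [← sub_eq_zero]
      have := sub_eq_zero.mpr hbar
      rw [← this]
      ring
    exact mul_left_cancel₀ hX0 h2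
  have hE0 : PowerSeries.constantCoeff E = 1 := by
    rw [hE, map_add, map_one, constantCoeff_invOnePlusSubOne, zero_add]
  have hconst := congrArg PowerSeries.constantCoeff hcancel
  simp only [map_mul, map_pow, map_neg, map_one, hE0, one_pow, one_mul, constantCoeff_subst_iota,
    constantCoeff_map', hκ0, hm0] at hconst
  -- `π(s) · (−1)^λ · w(0) = w(0)` with `w(0) ≠ 0`
  have hunit : π (s : ℤ_[p]) * (-1) ^ lam F = 1 := by
    have h3 : (π (s : ℤ_[p]) * (-1) ^ lam F - 1) * PowerSeries.constantCoeff w = 0 := by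
      linear_combination hconst
    exact sub_eq_zero.mp ((mul_eq_zero.mp h3).resolve_right hw0)
  -- characteristic `p ≠ 2`: `−1 ≠ 1` in `𝔽_p`
  have hneg : (-1 : IsLocalRing.ResidueField ℤ_[p]) ≠ 1 := by
    intro hm1
    have h2 : π 2 = 0 := by
      have : (2 : IsLocalRing.ResidueField ℤ_[p]) = 0 := by linear_combination -hm1
      rw [map_ofNat]; exact this
    rw [hπ, IsLocalRing.residue_eq_zero_iff, IsLocalRing.mem_maximalIdeal, PadicInt.mem_nonunits] at h2
    have h2' : ‖((2 : ℤ) : ℤ_[p])‖ < 1 := by exact_mod_cast h2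
    rw [PadicInt.norm_int_lt_one_iff_dvd] at h2'
    have : p ∣ 2 := by exact_mod_cast h2'
    exact hp2 ((Nat.prime_dvd_prime_iff_eq hp.out Nat.prime_two).mp this)
  rcases Nat.even_or_odd (lam F) with hev | hodd
  · rw [hev.neg_one_pow] at hunit ⊢
    rcases hs with rfl | rfl
    · rfl
    · exfalso
      rw [mul_one, Int.cast_neg, Int.cast_one, map_neg, map_one] at hunit
      exact hneg hunit
  · rw [hodd.neg_one_pow] at hunit ⊢
    rcases hs with rfl | rfl
    · exfalso
      rw [Int.cast_one, map_one, one_mul] at hunit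
      exact hneg hunit
    · rfl

end Algebra

/-! ## §2 X8: the mod-3 functional equation of each colour and the parity of `λ` -/

section X8

/-- `ι ∘ ι = id` on `ℚ_3⟦T⟧` (private plumbing). [folklore] -/
private theorem subst_subst_rat' (g : PowerSeries ℚ_[3]) :
    PowerSeries.subst (invOnePlusSubOne : PowerSeries ℚ_[3])
      (PowerSeries.subst (invOnePlusSubOne : PowerSeries ℚ_[3]) g) = g := by
  have hι := hasSubst_invOnePlusSubOne (R := ℚ_[3])
  rw [PowerSeries.subst_comp_subst_apply hι hι, invOnePlusSubOne_subst_self, PowerSeries.X_subst]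

/-- `det ℒ(0) = 1/9 ≠ 0` (private plumbing). [cite: Sprung2017, §3.1 (ℒ(0) = C⁻²)] -/
private theorem det_halfLogMatrix_ne_zero' (b : ℤ) :
    halfLogMatrix b 0 0 * halfLogMatrix b 1 1 - halfLogMatrix b 0 1 * halfLogMatrix b 1 0 ≠ 0 := by
  intro h
  have h0 := congrArg PowerSeries.constantCoeff h
  rw [map_sub, map_mul, map_mul, constantCoeff_halfLogMatrix, constantCoeff_halfLogMatrix,
    constantCoeff_halfLogMatrix, constantCoeff_halfLogMatrix, map_zero] at h0
  have hdetQ : (sprungCinv 3 (3 * b) ^ 2).det = 1 / 9 := by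
    rw [Matrix.det_pow, Matrix.det_fin_two]
    simp [sprungCinv]
    norm_num
  have hcast : (((sprungCinv 3 (3 * b) ^ 2).det : ℚ) : ℚ_[3]) = 0 := by
    rw [Matrix.det_fin_two]
    push_cast
    linear_combination h0
  rw [hdetQ] at hcast
  norm_num at hcast

/-- A power series all of whose coefficients are divisible by `3` is `C(3)·G` (private plumbing). [folklore] -/
private theorem exists_eq_C_mul_of_forall_dvd {M : IwasawaAlgebra 3} (h : ∀ j, (3 : ℤ_[3]) ∣ PowerSeries.coeff j M) :
    ∃ G : IwasawaAlgebra 3, M = PowerSeries.C ((3 : ℕ) : ℤ_[3]) * G := by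
  choose g hg using h
  refine ⟨PowerSeries.mk g, ?_⟩
  ext j
  rw [PowerSeries.coeff_C_mul, PowerSeries.coeff_mk, hg j]
  push_cast
  ring

/-- **THE MOD-3 FUNCTIONAL EQUATION OF EACH COLOUR (X8, class-wide, input-free).** For every X8 pair, newform `f` with
`f|W_N = −σf` (`σ² = 1`), Teichmüller exponent `c` of `N` and Sprung pair `(L♯, L♭)`: for each colour `•` there are `κ′, m, G ∈ Λ`
with `κ′·L^•(T^ι) = m·L^• + C(3)·G`, `κ′(0) = σ`, `m(0) = 1`. (Over `ℤ₃` itself the colours MIX: `κ′·L♯(T^ι) = M₀₀L♯ + M₁₀L♭` with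
`M₁₀ ≠ 0` but `M₁₀ ∈ 3Λ`.) [cite: Sprung2017, Thm. 4.13, Cor. 4.14, Prop. 3.14 and Cor. 4.4] [cite: MazurTateTeitelbaum1986Invent, §I.17] -/
theorem ClassX8.subst_congr_modThree (W : WeierstrassCurve ℚ) [W.IsElliptic] [W.IsGloballyMinimal] (p : ℕ) [Fact p.Prime]
    (hX : ClassX8 W p) {N : ℕ} [hN : NeZero N] (f : CuspForm (Gamma0 N) 2) (hf : IsNewformOf W f)
    {σ : ℤ} (hσ : σ ^ 2 = 1) (hW : IsFrickeEigen N f (-(σ : ℂ)))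
    (Lsharp Lflat : IwasawaAlgebra p) (hSP : IsSprungPair f p (W.frobeniusTrace p) Lsharp Lflat) (col : Chroma) :
    ∃ κ' m G : IwasawaAlgebra p, PowerSeries.constantCoeff κ' = σ ∧ PowerSeries.constantCoeff m = 1 ∧
      κ' * PowerSeries.subst (invOnePlusSubOne : IwasawaAlgebra p) (chromaticL col Lsharp Lflat) =
        m * chromaticL col Lsharp Lflat + PowerSeries.C (p : ℤ_[p]) * G := by
  obtain ⟨hp3, ⟨hgood, -⟩, -⟩ := id hX
  subst hp3
  haveI : NeZero N := hN
  obtain ⟨b, hb, hab⟩ : ∃ b : ℤ, (b = 1 ∨ b = -1) ∧ W.frobeniusTrace 3 = 3 * b := by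
    rcases ClassX8.frobeniusTrace_eq_three_or W 3 hX with h | h
    · exact ⟨1, Or.inl rfl, by rw [h]; norm_num⟩
    · exact ⟨-1, Or.inr rfl, by rw [h]; norm_num⟩
  rw [hab] at hSP
  have hpN : ¬ 3 ∣ N := not_dvd_level_of_isNewformOf hf hgood
  obtain ⟨ηN, c, hc⟩ := exists_teichmuller_exponent_natCast (p := 3) hpN
  have hFE := thm413_traceCoordinate_functionalEquation_three_holds W N f b hb hf hgood hab σ hσ hW ηN c hc
    invOnePlusSubOne one_add_X_mul_invOnePlusSubOne_add_one Lsharp Lflat hSP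
  obtain ⟨M, hM01, hM10, hM00, hM11, hM⟩ := exists_integral_halfLogMatrix_eq_mul_subst_modThree b
  -- cancelling `ℒ` (as in `…IotaStability`)
  have hι := hasSubst_invOnePlusSubOne (R := ℚ_[3])
  set τ : PowerSeries ℚ_[3] →+* PowerSeries ℚ_[3] := (PowerSeries.substAlgHom hι).toRingHom with hτ
  have hτapp : ∀ x : PowerSeries ℚ_[3], τ x = PowerSeries.subst (invOnePlusSubOne : PowerSeries ℚ_[3]) x :=
    fun x => by rw [hτ, AlgHom.toRingHom_eq_coe, RingHom.coe_coe, PowerSeries.coe_substAlgHom]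
  have hττ : ∀ x, τ (τ x) = x := fun x => by rw [hτapp, hτapp, subst_subst_rat']
  set κ : PowerSeries ℚ_[3] :=
    (σ : PowerSeries ℚ_[3]) * (PowerSeries.binomialSeries ℤ_[3] c).map (algebraMap ℤ_[3] ℚ_[3]) with hκ
  set L : Fin 2 → PowerSeries ℚ_[3] := ![iwasawaToPowerSeries 3 Lsharp, iwasawaToPowerSeries 3 Lflat] with hL
  have hL0 : L 0 = iwasawaToPowerSeries 3 Lsharp := rfl
  have hL1 : L 1 = iwasawaToPowerSeries 3 Lflat := rfl
  have hFE' : ∀ k : Fin 2, τ (L 0 * halfLogMatrix b 0 k + L 1 * halfLogMatrix b 1 k) =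
      κ * (L 0 * halfLogMatrix b 0 k + L 1 * halfLogMatrix b 1 k) := by
    intro k
    rw [hτapp, hL0, hL1]
    exact hFE k
  have hM' : ∀ i k : Fin 2, halfLogMatrix b i k =
      (M.map (iwasawaToPowerSeries 3)) i 0 * τ (halfLogMatrix b 0 k) +
        (M.map (iwasawaToPowerSeries 3)) i 1 * τ (halfLogMatrix b 1 k) := by
    intro i k
    rw [Matrix.map_apply, Matrix.map_apply, hτapp, hτapp]
    exact hM i k
  have key := mul_map_eq_of_traceFE τ hττ L (halfLogMatrix b) (M.map (iwasawaToPowerSeries 3)) κ hFE' hM'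
    (det_halfLogMatrix_ne_zero' b)
  -- pull back to `Λ`
  set κΛ : IwasawaAlgebra 3 := (σ : IwasawaAlgebra 3) * PowerSeries.binomialSeries ℤ_[3] c with hκΛ
  have hκι : κ = iwasawaToPowerSeries 3 κΛ := by rw [hκ, hκΛ, map_mul, map_intCast]
  have hpull : ∀ (Ll : IwasawaAlgebra 3) (m0 m1 : IwasawaAlgebra 3),
      τ κ * τ (iwasawaToPowerSeries 3 Ll) = iwasawaToPowerSeries 3 Lsharp * iwasawaToPowerSeries 3 m0 +
        iwasawaToPowerSeries 3 Lflat * iwasawaToPowerSeries 3 m1 →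
      PowerSeries.subst (invOnePlusSubOne : IwasawaAlgebra 3) κΛ *
          PowerSeries.subst (invOnePlusSubOne : IwasawaAlgebra 3) Ll = Lsharp * m0 + Lflat * m1 := by
    intro Ll m0 m1 h
    apply iwasawaToPowerSeries_injective 3
    rw [map_mul, map_add, map_mul, map_mul, iwasawaToPowerSeries_subst_invOnePlusSubOne,
      iwasawaToPowerSeries_subst_invOnePlusSubOne, ← hκι, ← hτapp, ← hτapp]
    exact h
  have hs : PowerSeries.subst (invOnePlusSubOne : IwasawaAlgebra 3) κΛ *
      PowerSeries.subst (invOnePlusSubOne : IwasawaAlgebra 3) Lsharp = Lsharp * M 0 0 + Lflat * M 1 0 := by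
    apply hpull
    have h := key 0
    rw [hL0, hL1, Matrix.map_apply, Matrix.map_apply] at h
    simpa using h
  have hfl : PowerSeries.subst (invOnePlusSubOne : IwasawaAlgebra 3) κΛ *
      PowerSeries.subst (invOnePlusSubOne : IwasawaAlgebra 3) Lflat = Lsharp * M 0 1 + Lflat * M 1 1 := by
    apply hpull
    have h := key 1
    rw [hL0, hL1, Matrix.map_apply, Matrix.map_apply] at h
    simpa using h
  -- the constant coefficient of `κ′ = κΛ(T^ι)` is `σ`
  have hκ0 : PowerSeries.constantCoeff (PowerSeries.subst (invOnePlusSubOne : IwasawaAlgebra 3) κΛ) = σ := by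
    rw [constantCoeff_subst_iota, hκΛ, map_mul, map_intCast, PowerSeries.binomialSeries_constantCoeff, mul_one]
  obtain ⟨G10, hG10⟩ := exists_eq_C_mul_of_forall_dvd hM10
  obtain ⟨G01, hG01⟩ := exists_eq_C_mul_of_forall_dvd hM01
  cases col with
  | sharp =>
    refine ⟨PowerSeries.subst (invOnePlusSubOne : IwasawaAlgebra 3) κΛ, M 0 0, Lflat * G10, hκ0, hM00, ?_⟩
    rw [chromaticL_sharp, hs, hG10]
    ring
  | flat =>
    refine ⟨PowerSeries.subst (invOnePlusSubOne : IwasawaAlgebra 3) κΛ, M 1 1, Lsharp * G01, hκ0, hM11, ?_⟩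
    rw [chromaticL_flat, hfl, hG01]
    ring

/-- **THE PARITY OF `λ` ON X8: `(−1)^{λ(L^•)} = σ`** for every colour with `μ(L^•) = 0`, `σ` the Fricke sign (`f|W_N = −σf`).
Class-wide, input-free. [cite: Sprung2017, Thm. 4.13 and Cor. 4.14] [cite: GreenbergLNM1716, §1 and Prop. 3.10]
[cite: MazurTateTeitelbaum1986Invent, §I.17] -/
theorem ClassX8.neg_one_pow_lam_eq_frickeSign (W : WeierstrassCurve ℚ) [W.IsElliptic] [W.IsGloballyMinimal] (p : ℕ)
    [Fact p.Prime] (hX : ClassX8 W p) {N : ℕ} [hN : NeZero N] (f : CuspForm (Gamma0 N) 2) (hf : IsNewformOf W f)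
    {σ : ℤ} (hσ : σ ^ 2 = 1) (hW : IsFrickeEigen N f (-(σ : ℂ)))
    (Lsharp Lflat : IwasawaAlgebra p) (hSP : IsSprungPair f p (W.frobeniusTrace p) Lsharp Lflat) (col : Chroma)
    (hμ : mu (chromaticL col Lsharp Lflat) = 0) : (-1 : ℤ) ^ lam (chromaticL col Lsharp Lflat) = σ := by
  obtain ⟨κ', m, G, hκ0, hm0, h⟩ := ClassX8.subst_congr_modThree W p hX f hf hσ hW Lsharp Lflat hSP col
  have hp3 : p = 3 := hX.1
  have hL0 : chromaticL col Lsharp Lflat ≠ 0 := by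
    obtain ⟨hs, hfl⟩ := ChromaticBothColours.ClassX8.sharp_ne_zero_and_flat_ne_zero W p hX N hN f Lsharp Lflat hf hSP
    cases col with
    | sharp => simpa using hs
    | flat => simpa using hfl
  have hs1 : σ = 1 ∨ σ = -1 := by
    have : (σ - 1) * (σ + 1) = 0 := by linear_combination hσ
    rcases mul_eq_zero.mp this with h1 | h1
    · exact Or.inl (by linear_combination h1)
    · exact Or.inr (by linear_combination h1)
  exact neg_one_pow_lam_eq_of_subst_congr (by rw [hp3]; decide) hL0 hμ hs1 hκ0 hm0 h

/-- **`λ(L♯) ≡ λ(L♭) (mod 2)` on X8** whenever `μ(L♯) = μ(L♭) = 0` (both equal the parity of the Fricke sign; σ-free form —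
the Fricke sign of the newform exists by the tree's Atkin–Lehner theorems). Class-wide, input-free.
[cite: Sprung2017, Thm. 4.13 and Cor. 4.14] [cite: GreenbergLNM1716, Prop. 3.10] -/
theorem ClassX8.lam_sharp_mod_two_eq_lam_flat_mod_two (W : WeierstrassCurve ℚ) [W.IsElliptic] [W.IsGloballyMinimal]
    (p : ℕ) [Fact p.Prime] (hX : ClassX8 W p) {N : ℕ} [hN : NeZero N] (f : CuspForm (Gamma0 N) 2)
    (hf : IsNewformOf W f) (Lsharp Lflat : IwasawaAlgebra p) (hSP : IsSprungPair f p (W.frobeniusTrace p) Lsharp Lflat)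
    (hμs : mu Lsharp = 0) (hμf : mu Lflat = 0) : lam Lsharp % 2 = lam Lflat % 2 := by
  haveI : NeZero N := hN
  -- the Fricke sign of the newform
  have hsm := IsNewform0.frickeInvolution_eq_smul_holds (N := N) (k := (2 : ℤ)) hf.1
  have hFr : IsFrickeEigen N f (frickeEigenvalue f) := isFrickeEigen_of_frickeInvolution_eq_smul N hsm
  obtain ⟨σ, hσ, hW⟩ : ∃ σ : ℤ, σ ^ 2 = 1 ∧ IsFrickeEigen N f (-(σ : ℂ)) := by
    rcases IsNewform0.frickeEigenvalue_eq_one_or_eq_neg_one_holds (N := N) (k := (2 : ℤ)) hf.1 with h1 | h1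
    · refine ⟨-1, by norm_num, ?_⟩
      have : (-((-1 : ℤ) : ℂ)) = frickeEigenvalue f := by rw [h1]; push_cast; ring
      rw [this]; exact hFr
    · refine ⟨1, by norm_num, ?_⟩
      have : (-((1 : ℤ) : ℂ)) = frickeEigenvalue f := by rw [h1]; push_cast; ring
      rw [this]; exact hFr
  have hs := ClassX8.neg_one_pow_lam_eq_frickeSign W p hX f hf hσ hW Lsharp Lflat hSP Chroma.sharp
    (by simpa using hμs)
  have hfl := ClassX8.neg_one_pow_lam_eq_frickeSign W p hX f hf hσ hW Lsharp Lflat hSP Chroma.flat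
    (by simpa using hμf)
  rw [chromaticL_sharp] at hs
  rw [chromaticL_flat] at hfl
  rcases Nat.even_or_odd (lam Lsharp) with h1 | h1 <;> rcases Nat.even_or_odd (lam Lflat) with h2 | h2
  · rw [Nat.even_iff.mp h1, Nat.even_iff.mp h2]
  · exfalso
    rw [h1.neg_one_pow] at hs
    rw [h2.neg_one_pow] at hfl
    have : (1 : ℤ) = -1 := hs.trans hfl.symm
    omega
  · exfalso
    rw [h1.neg_one_pow] at hs
    rw [h2.neg_one_pow] at hfl
    have : (-1 : ℤ) = 1 := hs.trans hfl.symm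
    omega
  · rw [Nat.odd_iff.mp h1, Nat.odd_iff.mp h2]

end X8

end Summit.BirchSwinnertonDyer.BirchSwinnertonDyer.Theorems.ChromaticIota

end
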